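import Literature.NumberTheory.EllipticCurves.IsogenyLocalPointsMaps
import Literature.NumberTheory.EllipticCurves.VariableChangePointsGalois
import Literature.NumberTheory.EllipticCurves.VariableChangePointsMap
import Literature.NumberTheory.EllipticCurves.IrreducibleModPQuadraticTwistProofs
import Literature.NumberTheory.EllipticCurves.ComplexMultiplicationTwistIsogenyProofs
import Literature.NumberTheory.EllipticCurves.Sha
import HarnessLib

/-!
# The local untwisting isomorphism `E(K̄_v) ≃ E₀(K̄_v)` for `E = W_K`, `C • W = cm7^{(d)}`, `E₀ = cm7_K`, equivariant
# for the Galois elements fixing `√d`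

Crux `stmt-BirchSwinnertonDyer-20368` (`PrintCf2.SplitBadTwoRankOneOfFacts`), road α, LEAD ruling (R-ET) 2026-08-29, brick (ET-v)
(«`2 • res_{D_v}(e_* κ_n(Q)) = 0`», hfin-free). Piece B needs Greenberg's point-level input «on the inertia of `K_v(√d)` a
Kummer cocycle of `E` takes values in the kernel of reduction of the GOOD curve `E₀ = cm7`» (LNM 1716 §2 Prop. 2.2); the
tree's reduction theory (`WeierstrassCurve.localKernelOfReduction`, `smul_sub_mem_localKernelOfReduction_of_mem_absInertia`)
speaks about the local points `localPoints (cm7.baseChange K) K_v` of the good curve, so this file TRANSPORTS local points: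
* `exists_localUntwist` — for `W/ℚ` with `C • W = cm7^{(d)}`, `d ≠ 0`, a number field `K` and a finite place `v`, there are
  `θ ∈ K̄_v` with `θ² = d` and an additive isomorphism `T : E(K̄_v) ≃+ E₀(K̄_v)` (`E = W_K`, `E₀ = cm7_K`; the change of
  variables `C₁⁻¹ ∘ (θ, 0, 0, 0) ∘ C` over `K̄_v`, `C₁` completing the square on `cm7`) such that `T (σ • P) = σ • T P` for
  every `σ ∈ Γ_{K_v}` with `σ θ = θ` (Silverman, *AEC* X.5 Cor. 5.4 (iii): `E^{(d)} ≅ E` over any field containing `√d`;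
  *ATAEC* Lemma V.5.2 (c): `ψ(P^σ) = ψ(P)^σ` when `σ` fixes the coefficients of `ψ`).
No definition (the isomorphism is an `∃`), no named fact, no `sorry`. BSD is not proved by any of this.

References: [SilvermanAEC2009] J. H. Silverman, *AEC*, X.5 Cor. 5.4, III.3.1(b); [SilvermanATAEC1994] Lemma V.5.2 (c);
[GreenbergLNM1716] R. Greenberg, LNM 1716 (1999), §2 Prop. 2.2.
-/

noncomputable section

open scoped Classical

set_option linter.dupNamespace false

namespace Summit.BirchSwinnertonDyer.BirchSwinnertonDyer.Theorems.PrintCf2.CMPrimes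

open NumberField IsDedekindDomain Field WeierstrassCurve WeierstrassCurve.VariableChange
  Literature.NumberTheory.EllipticCurves

variable {K : Type} [Field K] [NumberField K]

/-- **The composite change of variables `C₁⁻¹ ∘ (θ,0,0,0) ∘ C` carries `E_L = (W_K)_L` to `(E₀)_L = (cm7_K)_L`** over any
`K`-field `L ∋ θ`, `θ² = d` (`C • W = cm7^{(d)}`, `C₁ • cm7_K = cm7_K^{(1)}` completing the square).
[cite: SilvermanAEC2009, X.5 Cor. 5.4 (iii)] -/
theorem localUntwist_smul_eq {d : ℤ} (W : WeierstrassCurve ℚ) (C : VariableChange ℚ)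
    (hCW : C • W = cm7.quadraticTwist (d : ℚ)) {L : Type*} [Field L] [Algebra K L] {θ : L}
    (hθ2 : θ ^ 2 = algebraMap K L (algebraMap ℚ K (d : ℚ))) (hθ : θ ≠ 0) (C₁ : VariableChange K)
    (hC₁ : C₁ • cm7.baseChange K = (cm7.baseChange K).quadraticTwist 1) :
    ((C₁.map (algebraMap K L))⁻¹ * (untwistAt hθ * (C.map (algebraMap ℚ K)).map (algebraMap K L))) •
        (W.baseChange K).baseChange L = (cm7.baseChange K).baseChange L := by
  haveI : NeZero (2 : K) := ⟨two_ne_zero⟩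
  haveI hnf : ((cm7.baseChange K).quadraticTwist 1).IsCharNeTwoNF := ⟨rfl, rfl⟩
  have hCKV : C.map (algebraMap ℚ K) • W.baseChange K =
      ((cm7.baseChange K).quadraticTwist 1).quadraticTwist (algebraMap ℚ K d) := by
    rw [← baseChange_smul_eq W C K, hCW, baseChange_quadraticTwist, quadraticTwist_quadraticTwist, one_mul]
  rw [mul_smul, mul_smul, ← baseChange_smul_eq (W.baseChange K) (C.map (algebraMap ℚ K)) L, hCKV,
    untwistAt_smul_eq ((cm7.baseChange K).quadraticTwist 1) hθ2 hθ, ← hC₁, baseChange_smul_eq (cm7.baseChange K) C₁ L,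
    inv_smul_smul]

/-- The composite change of variables is fixed by every `K`-algebra endomorphism of `L` fixing `θ`.
[cite: SilvermanATAEC1994, Lemma V.5.2 (c)] -/
theorem map_localUntwist_eq (C : VariableChange ℚ) {L : Type*} [Field L] [Algebra K L] {θ : L} (hθ : θ ≠ 0)
    (C₁ : VariableChange K) (f : L →ₐ[K] L) (hf : f θ = θ) :
    ((C₁.map (algebraMap K L))⁻¹ * (untwistAt hθ * (C.map (algebraMap ℚ K)).map (algebraMap K L))).map (f : L →+* L) =
      (C₁.map (algebraMap K L))⁻¹ * (untwistAt hθ * (C.map (algebraMap ℚ K)).map (algebraMap K L)) := by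
  have hfix : ∀ D : VariableChange K, (D.map (algebraMap K L)).map (f : L →+* L) = D.map (algebraMap K L) := fun D ↦ by
    rw [VariableChange.map_map, AlgHom.comp_algebraMap]
  have hu : (untwistAt hθ).map (f : L →+* L) = untwistAt hθ := by
    ext <;> simp [VariableChange.map, untwistAt, hf]
  have hmul : ∀ A B : VariableChange L, (A * B).map (f : L →+* L) = A.map (f : L →+* L) * B.map (f : L →+* L) :=
    fun A B ↦ (mapHom (f : L →+* L)).map_mul A B
  have hinv : ∀ A : VariableChange L, A⁻¹.map (f : L →+* L) = (A.map (f : L →+* L))⁻¹ :=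
    fun A ↦ (mapHom (f : L →+* L)).map_inv A
  rw [hmul, hmul, hinv, hfix, hfix, hu]

/-- **The local untwisting isomorphism, equivariant on the stabiliser of `√d`.** For `W/ℚ` with `C • W = cm7^{(d)}`, `d ≠ 0`,
a number field `K` and ANY `K`-field `E` (meant: a completion `K_v`): there are `θ ∈ Ē` with `θ² = d` and
`T : E(Ē) ≃+ E₀(Ē)` (`E = W_K`, `E₀ = cm7_K`, local points `localPoints · E` over `Ē = AlgebraicClosure E`) with
`T (σ • P) = σ • T P` whenever `σ ∈ Γ_E` fixes `θ`. [cite: SilvermanAEC2009, X.5 Cor. 5.4 (iii)] [cite: SilvermanATAEC1994, Lemma V.5.2 (c)] -/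
theorem exists_localUntwist {d : ℤ} (hd0 : d ≠ 0) (W : WeierstrassCurve ℚ) (C : VariableChange ℚ)
    (hCW : C • W = cm7.quadraticTwist (d : ℚ)) (E : Type) [Field E] [Algebra K E] :
    ∃ (θ : AlgebraicClosure E)
      (T : localPoints (W.baseChange K) E ≃+ localPoints (cm7.baseChange K) E),
      θ ^ 2 = algebraMap K (AlgebraicClosure E) d ∧ θ ≠ 0 ∧
      ∀ σ : absoluteGaloisGroup E,
        (AlgEquiv.restrictScalars K (show AlgebraicClosure E ≃ₐ[E] AlgebraicClosure E from σ)) θ = θ →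
        ∀ P, T (σ • P) = σ • T P := by
  haveI : NeZero (2 : K) := ⟨two_ne_zero⟩
  -- a square root of `d` in `Ē`
  obtain ⟨θ, hθ2⟩ := IsAlgClosed.exists_pow_nat_eq (algebraMap K (AlgebraicClosure E) d) two_pos
  have hdL : algebraMap K (AlgebraicClosure E) d ≠ 0 := by
    rw [map_ne_zero_iff _ (algebraMap K _).injective]; exact_mod_cast hd0
  have hθ : θ ≠ 0 := by rintro rfl; rw [zero_pow two_ne_zero] at hθ2; exact hdL hθ2.symm
  have hθ2K : θ ^ 2 = algebraMap K (AlgebraicClosure E) (algebraMap ℚ K (d : ℚ)) := by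
    rw [map_intCast]; exact hθ2
  obtain ⟨C₁, hC₁⟩ := exists_variableChange_quadraticTwist_one (cm7.baseChange K)
  have hsmul := localUntwist_smul_eq (K := K) W C hCW hθ2K hθ C₁ hC₁
  refine ⟨θ, (pointEquiv _ _).trans (Affine.Point.congrEquiv hsmul), hθ2, hθ, fun σ hσ P ↦ ?_⟩
  rw [localPoints.smul_def, localPoints.smul_def]
  exact (map_congrEquiv_pointEquiv_of_map_eq (W.baseChange K) (cm7.baseChange K) _ hsmul _
    (map_localUntwist_eq (K := K) C hθ C₁ _ hσ) P).symm

end Summit.BirchSwinnertonDyer.BirchSwinnertonDyer.Theorems.PrintCf2.CMPrimes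

end
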